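import Literature.Topology.FourManifolds.OneManifoldCircle
import Literature.Topology.FourManifolds.HomotopySpheresGroupLeaves
import Literature.Topology.FourManifolds.HomotopySpheresInverseBoundsContractible
import Literature.Topology.FourManifolds.HomotopySpheresSumDimOne
import HarnessLib

/-!
# The group `Θₙ`: `Θ₁ = 0` unconditionally, and Theorem 1.1 from four named facts

Sibling proofs file of `HomotopySpheresGroup.lean` / `HomotopySpheresGroupProofs.lean` /
`HomotopySpheresGroupAssembly.lean` / `HomotopySpheresGroupLeaves.lean`, the decomposition of the
named fact `Literature.Topology.FourManifolds.exists_commGroup_homotopySphereClass`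
(Kervaire–Milnor's Theorem 1.1, *Groups of homotopy spheres I*, Ann. of Math. 77 (1963), for the
oriented-diffeomorphism classes `Θₙ = HomotopySphereClass n`, `n ≠ 0, 4`). Two of the six leaves of
`exists_commGroup_homotopySphereClass_of_ne_three_of_sixLeaves` have become theorems of the tree
and are fed in here:

* the classification of curves, in the oriented form that the assembly actually uses — every
  compact connected oriented smooth `1`-manifold is diffeomorphic to `𝕊¹`
  (`nonempty_diffeomorph_sphere_one_of_smoothOrientation`, `OneManifoldCircle.lean`; Milnor 1965,
  Appendix) — whence **`Θ₁ = 0` unconditionally** (Kervaire–Milnor, p. 507: "Clearly `Θ₁` is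
  zero"): `HomotopySphere.nonempty_diffeomorph_sphere_one`, `HomotopySphereClass.subsingleton_one`,
  `HomotopySphereClass.natCard_one` (`|Θ₁| = 1`), and the dimension-`1` instance of Theorem 1.1,
  `exists_commGroup_homotopySphereClass_one` (**proved**, no hypotheses);
* Kervaire–Milnor's rotation construction in the proof of Lemma 2.4
  (`HomotopySphere.exists_nullCobordism_isOrientedConnectedSum_neg_holds`,
  `HomotopySpheresInverseBoundsContractible.lean`).

Results (all **proved**; no new definitions or named facts):

* `HomotopySphere.contractibleSpace_compl_image_ball_of_two`: the named fact "a homotopy sphere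
  with an open disc deleted is contractible" (all `n`) from the classification of surfaces
  (`nonemptyDiffeomorphSphere_two`) and Whitehead–Hurewicz only, the dimension-`1` case being the
  theorem `HomotopySphere.contractibleSpace_compl_image_ball_one` of `HomotopySpheresSumDimOne.lean`
  (contractibility of punctured oriented `1`-manifolds along the flow, `OneManifoldOrbits.lean`);
* `exists_commGroup_homotopySphereClass_of_ne_three_of_fourLeaves`: Theorem 1.1 for diffeomorphism
  classes in the dimensions `n ≠ 0, 3, 4` covered by the source
  (`exists_commGroup_homotopySphereClass_of_ne_three`) from FOUR named facts — (1) the smooth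
  Poincaré conjecture in dimension `2` (`nonemptyDiffeomorphSphere_two`, classification of
  surfaces), (2) the Whitehead–Hurewicz recognition of contractible manifolds
  (`Literature.AlgebraicTopology.Homotopy.Manifold.contractibleSpace_of_simplyConnected_of_acyclic`),
  (3) the homotopy theory in the proof of Lemma 2.3
  (`NullCobordism.isHomotopyEquiv_compl_ball_of_contractibleSpace`), (4) Smale's h-cobordism
  theorem (`nonempty_diffeomorph_of_isHCobordant_of_five_le`, spc4.S15);
  `…_of_ne_three_of_hurewiczSubsingleton`: the same with (2) replaced by its own inputs, the
  vanishing Hurewicz theorem and Milnor's CW-type theorem;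
* `exists_commGroup_homotopySphereClass_of_fourLeaves_of_three`: the tree's fact (all `n ≠ 0, 4`)
  from those four and the Poincaré conjecture (spc4.S31, Perelman) for `n = 3`.

## References

* M. Kervaire, J. Milnor, *Groups of homotopy spheres I*, Ann. of Math. (2) 77 (1963), 504–537:
  Thm 1.1 (p. 504), §2 pp. 505–507. doi:10.2307/1970128 [KervaireMilnorAnnals1963]
* J. Milnor, *Topology from the Differentiable Viewpoint* (1965), Appendix: Classifying
  one-manifolds. [MilnorTDV1965]
* J. Milnor, *Lectures on the h-cobordism theorem*, Princeton (1965), Thm 9.1. [MilnorHCobordism1965]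
* J. W. Morgan, G. Tian, *Ricci Flow and the Poincaré Conjecture* (2007), Cor. 0.2 (a). [MorganTian2007]
-/

open scoped Manifold ContDiff Topology ContinuousMap
open Set

noncomputable section

namespace Literature.Topology.FourManifolds

/-! ### `Θ₁ = 0` -/

/-- **Every homotopy `1`-sphere is diffeomorphic to `𝕊¹`.** A homotopy `1`-sphere of the tree is a
compact, connected (`HomotopySphere.connectedSpace`), Hausdorff smooth `1`-manifold with an
orientation, hence a circle (`nonempty_diffeomorph_sphere_one_of_smoothOrientation`,
`OneManifoldCircle.lean`: Milnor 1965, Appendix). Kervaire–Milnor, *Groups of homotopy spheres I*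
(1963), p. 507: "Clearly `Θ₁` is zero." [cite: KervaireMilnorAnnals1963, §2 p. 507] [cite: MilnorTDV1965, Appendix (Classifying one-manifolds)] -/
theorem HomotopySphere.nonempty_diffeomorph_sphere_one (S : HomotopySphere 1) :
    Nonempty (S.carrier ≃ₘ⟮𝓡 1, 𝓡 1⟯ (Metric.sphere (0 : EuclideanSpace ℝ (Fin (1 + 1))) 1)) := by
  haveI := S.connectedSpace one_ne_zero
  exact nonempty_diffeomorph_sphere_one_of_smoothOrientation S.orientation

/-- **`Θ₁ = 0`**: the oriented-diffeomorphism classes of homotopy `1`-spheres form a single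
point (Kervaire–Milnor 1963, p. 507: "Clearly `Θ₁` is zero"), by
`HomotopySphere.nonempty_diffeomorph_sphere_one` and
`HomotopySphereClass.subsingleton_of_nonempty_diffeomorph_sphere` (a diffeomorphism to `𝕊¹`
either preserves or reverses the orientations, and `[𝕊¹, -o] = [𝕊¹, o]`).
[cite: KervaireMilnorAnnals1963, §2 p. 507] -/
theorem HomotopySphereClass.subsingleton_one : Subsingleton (HomotopySphereClass 1) :=
  HomotopySphereClass.subsingleton_of_nonempty_diffeomorph_sphere one_ne_zero
    HomotopySphere.nonempty_diffeomorph_sphere_one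

/-- **`|Θ₁| = 1`**: there is exactly one oriented-diffeomorphism class of homotopy `1`-spheres
(the class of `𝕊¹`; Kervaire–Milnor 1963, p. 507, "`Θ₁` is zero", in the counting form used for
the orders `|Θₙ|` elsewhere in the tree). [cite: KervaireMilnorAnnals1963, §2 p. 507] -/
theorem HomotopySphereClass.natCard_one : Nat.card (HomotopySphereClass 1) = 1 := by
  obtain ⟨o₀⟩ := (isOrientable_sphere_holds 1 : Nonempty _)
  haveI := HomotopySphereClass.subsingleton_one
  exact Nat.card_eq_one_iff_unique.2
    ⟨inferInstance, ⟨HomotopySphereClass.mk (HomotopySphere.sphere o₀)⟩⟩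

/-- **Kervaire–Milnor's Theorem 1.1 in dimension `1`, unconditionally**: `Θ₁` carries a
commutative group structure whose multiplication is the connected sum, whose unit is `[𝕊¹]` with
any orientation and whose inverse is orientation reversal — the instance `n = 1` of the named
fact `exists_commGroup_homotopySphereClass`, now a theorem (`Θ₁` is a point,
`HomotopySphereClass.subsingleton_one`, and the trivial group does it,
`HomotopySphereClass.exists_commGroup_of_subsingleton`). [cite: KervaireMilnorAnnals1963, Thm. 1.1 and §2 p. 507] -/
theorem exists_commGroup_homotopySphereClass_one :
    ∃ _ : CommGroup (HomotopySphereClass 1),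
      (∀ a b c : HomotopySphereClass 1, HomotopySphereClass.IsMul a b c → a * b = c) ∧
      (∀ o : SmoothOrientation (𝓡 1) (Metric.sphere (0 : EuclideanSpace ℝ (Fin (1 + 1))) 1),
        (HomotopySphereClass.mk ⟨Metric.sphere (0 : EuclideanSpace ℝ (Fin (1 + 1))) 1, o, ⟨.refl _⟩⟩ : HomotopySphereClass 1) = 1) ∧
      ∀ a : HomotopySphereClass 1, a⁻¹ = a.neg := by
  obtain ⟨o₀⟩ := (isOrientable_sphere_holds 1 : Nonempty _)
  haveI := HomotopySphereClass.subsingleton_one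
  exact HomotopySphereClass.exists_commGroup_of_subsingleton o₀

/-- **Homotopy spheres of dimension `1, 2` are standard, given the classification of surfaces
only** (`nonemptyDiffeomorphSphere_two`, the smooth Poincaré conjecture in dimension `2`): the
dimension-`1` case is the theorem `HomotopySphere.nonempty_diffeomorph_sphere_one`.
Kervaire–Milnor 1963, p. 507: `Θ₁ = Θ₂ = 0`. [cite: KervaireMilnorAnnals1963, §2 p. 507] -/
theorem HomotopySphere.nonempty_diffeomorph_sphere_of_le_two (h2 : nonemptyDiffeomorphSphere_two.{0})
    (n : ℕ) (S : HomotopySphere n) (h1 : 1 ≤ n) (hn : n ≤ 2) :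
    Nonempty (S.carrier ≃ₘ⟮𝓡 n, 𝓡 n⟯ (Metric.sphere (0 : EuclideanSpace ℝ (Fin (n + 1))) 1)) := by
  interval_cases n
  · exact S.nonempty_diffeomorph_sphere_one
  · obtain ⟨e⟩ := S.nonempty_homotopyEquiv
    exact h2 S.carrier S.chartedSpace S.isManifold e

/-! ### Punctured homotopy spheres and sums, the dimension-`1` input discharged -/

/-- **Punctured homotopy spheres are contractible, from Whitehead–Hurewicz and the classification
of surfaces** — the named fact `HomotopySphere.contractibleSpace_compl_image_ball` (all `n`) GIVEN
(a) `Literature.AlgebraicTopology.Homotopy.Manifold.contractibleSpace_of_simplyConnected_of_acyclic`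
(`n ≥ 3`) and (b) the smooth Poincaré conjecture in dimension `2` (`nonemptyDiffeomorphSphere_two`,
`n = 2`), both through `HomotopySphere.contractibleSpace_compl_singleton_of`; dimensions `0` and
`1` are theorems (`HomotopySphere.contractibleSpace_compl_image_ball_zero`;
`HomotopySphere.contractibleSpace_compl_image_ball_one` of `HomotopySpheresSumDimOne.lean`, flow on
an oriented `1`-manifold), fed in by `HomotopySphere.contractibleSpace_compl_image_ball_of_compl_singleton`.
Sharpens `HomotopySphere.contractibleSpace_compl_image_ball_of`, which also assumes the
dimension-`1` case. [cite: Kosinski1993, Ch. VI §1 (remark before Cor. 1.4)] [cite: KervaireMilnorAnnals1963, Lemma 2.4, proof (p. 507)] -/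
theorem HomotopySphere.contractibleSpace_compl_image_ball_of_two
    (h2 : nonemptyDiffeomorphSphere_two.{0})
    (hW : Literature.AlgebraicTopology.Homotopy.Manifold.contractibleSpace_of_simplyConnected_of_acyclic.{0}) :
    HomotopySphere.contractibleSpace_compl_image_ball :=
  HomotopySphere.contractibleSpace_compl_image_ball_of_compl_singleton
    (HomotopySphere.contractibleSpace_compl_singleton_of hW fun M _ _ _ => h2 M)

/-! ### Theorem 1.1 for `n ≠ 0, 3, 4` from four named facts -/

/-- **Kervaire–Milnor's Theorem 1.1 for diffeomorphism classes in dimensions `n ≠ 0, 3, 4`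
(`exists_commGroup_homotopySphereClass_of_ne_three`) from FOUR named facts**: (1) the
classification of surfaces in the form of the smooth Poincaré conjecture in dimension `2`
(`nonemptyDiffeomorphSphere_two`; Kervaire–Milnor p. 507: `Θ₂ = 0`), (2) simply connected acyclic
manifolds are contractible
(`Literature.AlgebraicTopology.Homotopy.Manifold.contractibleSpace_of_simplyConnected_of_acyclic`;
Whitehead–Hurewicz), (3) the homotopy theory in the proof of Lemma 2.3
(`NullCobordism.isHomotopyEquiv_compl_ball_of_contractibleSpace`), (4) Smale's h-cobordism
theorem (`nonempty_diffeomorph_of_isHCobordant_of_five_le`, spc4.S15). Compared with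
`exists_commGroup_homotopySphereClass_of_ne_three_of_sixLeaves`, two inputs are now theorems:
the classification of compact oriented `1`-manifolds (`HomotopySphere.nonempty_diffeomorph_sphere_one`,
`OneManifoldCircle.lean`; `Θ₁ = 0`) and Kervaire–Milnor's rotation construction of Lemma 2.4
(`HomotopySphere.exists_nullCobordism_isOrientedConnectedSum_neg_holds`,
`HomotopySpheresInverseBoundsContractible.lean`). Dimensions `1, 2`: `Θₙ` is a point; dimensions
`≥ 5`: the class-level Lemmas 2.1–2.4 (`HomotopySphereClass.groupLawFacts_of_fourFacts`) and the
algebra of Theorem 1.1 (`HomotopySphereClass.GroupLawFacts.exists_commGroup`).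
[cite: KervaireMilnorAnnals1963, Thm. 1.1, §2 pp. 504–507] [cite: MilnorHCobordism1965, Thm. 9.1] -/
theorem exists_commGroup_homotopySphereClass_of_ne_three_of_fourLeaves
    (h2 : nonemptyDiffeomorphSphere_two.{0})
    (hW : Literature.AlgebraicTopology.Homotopy.Manifold.contractibleSpace_of_simplyConnected_of_acyclic.{0})
    (h23b : NullCobordism.isHomotopyEquiv_compl_ball_of_contractibleSpace)
    (hS15 : FourManifolds.nonempty_diffeomorph_of_isHCobordant_of_five_le.{0}) :
    exists_commGroup_homotopySphereClass_of_ne_three := by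
  have hKball := HomotopySphere.contractibleSpace_compl_image_ball_of_two h2 hW
  intro n h0 h3 h4
  obtain ⟨o₀⟩ := (isOrientable_sphere_holds n : Nonempty _)
  by_cases h2' : n ≤ 2
  · haveI := HomotopySphereClass.subsingleton_of_nonempty_diffeomorph_sphere h0 fun S =>
      HomotopySphere.nonempty_diffeomorph_sphere_of_le_two h2 n S (Nat.one_le_iff_ne_zero.mpr h0) h2'
    exact HomotopySphereClass.exists_commGroup_of_subsingleton o₀
  · exact (HomotopySphereClass.groupLawFacts_of_fourFacts (by omega)
      (HomotopySphere.nonempty_homotopyEquiv_sphere_of_isConnectedSum_of hKball)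
      (HomotopySphere.isHCobordant_sphere_of_isOrientedConnectedSum_neg_of_leaves hKball h23b
        HomotopySphere.exists_nullCobordism_isOrientedConnectedSum_neg_holds)
      hS15).exists_commGroup o₀

/-- **Theorem 1.1 for `n ≠ 0, 3, 4` from the finest leaves that remain named facts**: as
`exists_commGroup_homotopySphereClass_of_ne_three_of_fourLeaves`, with the Whitehead–Hurewicz
recognition principle replaced by its own two inputs — the vanishing form of the Hurewicz
theorem (`Literature.AlgebraicTopology.SingularHomology.hurewicz_subsingleton`, Hatcher 2002,
Thm. 4.32) and Milnor's theorem that manifolds have the homotopy type of CW complexes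
(`Literature.AlgebraicTopology.Homotopy.Manifold.exists_cwComplex_homotopyEquiv`, Milnor 1959,
Cor. 1) — through `contractibleSpace_of_simplyConnected_of_acyclic_of_hurewiczSubsingleton_of_cwType`
(`HomotopySpheresInverseBoundsContractible.lean`). Five named facts in all: surfaces, Hurewicz,
CW type, the homotopy theory of Lemma 2.3, Smale's h-cobordism theorem.
[cite: KervaireMilnorAnnals1963, Thm. 1.1, §2 pp. 504–507] [cite: MilnorHCobordism1965, Thm. 9.1] -/
theorem exists_commGroup_homotopySphereClass_of_ne_three_of_hurewiczSubsingleton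
    (h2 : nonemptyDiffeomorphSphere_two.{0})
    (hH : Literature.AlgebraicTopology.SingularHomology.hurewicz_subsingleton.{0})
    (hCW : Literature.AlgebraicTopology.Homotopy.Manifold.exists_cwComplex_homotopyEquiv.{0})
    (h23b : NullCobordism.isHomotopyEquiv_compl_ball_of_contractibleSpace)
    (hS15 : FourManifolds.nonempty_diffeomorph_of_isHCobordant_of_five_le.{0}) :
    exists_commGroup_homotopySphereClass_of_ne_three :=
  exists_commGroup_homotopySphereClass_of_ne_three_of_fourLeaves h2
    (contractibleSpace_of_simplyConnected_of_acyclic_of_hurewiczSubsingleton_of_cwType hH hCW)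
    h23b hS15

/-! ### Kervaire–Milnor's Theorem 1.1 (the tree's fact) from five named facts -/

/-- **Kervaire–Milnor's Theorem 1.1 for `Θₙ = HomotopySphereClass n`, `n ≠ 0, 4` (the tree's
fact `exists_commGroup_homotopySphereClass`), from five named facts**: the four of
`exists_commGroup_homotopySphereClass_of_ne_three_of_fourLeaves` — (1) the smooth Poincaré
conjecture in dimension `2` (`nonemptyDiffeomorphSphere_two`: classification of surfaces;
Kervaire–Milnor p. 507), (2) Whitehead–Hurewicz
(`Literature.AlgebraicTopology.Homotopy.Manifold.contractibleSpace_of_simplyConnected_of_acyclic`),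
(3) the homotopy theory of Lemma 2.3 (`NullCobordism.isHomotopyEquiv_compl_ball_of_contractibleSpace`),
(4) Smale's h-cobordism theorem (`nonempty_diffeomorph_of_isHCobordant_of_five_le`, spc4.S15) — and
(5) the Poincaré conjecture (spc4.S31 `nonempty_diffeomorph_sphere_three`: Perelman, Morgan–Tian
Cor. 0.2 (a)) for the instance `n = 3` (`exists_commGroup_homotopySphereClass_of_ne_three_of_three`).
The classification of curves (`Θ₁ = 0`), the rotation construction of Lemma 2.4, and all the
differential topology of §2 (existence, Palais–Cerf uniqueness, unit, associativity,
commutativity of oriented connected sums, the ball removal of Lemma 2.3, inverses from Lemmas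
2.3–2.4 and Smale, the group axioms) are theorems of the tree.
[cite: KervaireMilnorAnnals1963, Thm. 1.1, §2 pp. 504–507] [cite: MilnorHCobordism1965, Thm. 9.1] [cite: MorganTian2007, Cor. 0.2 (a)] -/
theorem exists_commGroup_homotopySphereClass_of_fourLeaves_of_three
    (h2 : nonemptyDiffeomorphSphere_two.{0})
    (h3 : FourManifolds.nonempty_diffeomorph_sphere_three.{0})
    (hW : Literature.AlgebraicTopology.Homotopy.Manifold.contractibleSpace_of_simplyConnected_of_acyclic.{0})
    (h23b : NullCobordism.isHomotopyEquiv_compl_ball_of_contractibleSpace)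
    (hS15 : FourManifolds.nonempty_diffeomorph_of_isHCobordant_of_five_le.{0}) :
    exists_commGroup_homotopySphereClass :=
  exists_commGroup_homotopySphereClass_of_ne_three_of_three
    (exists_commGroup_homotopySphereClass_of_ne_three_of_fourLeaves h2 hW h23b hS15) h3

end Literature.Topology.FourManifolds
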